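import Summits.Ventures.HSemireg.WedgeHankelSubstitutionJordanBlocks
import Summits.Ventures.HSemireg.WedgeHankelClassSpaceAlgebra

/-!
# Venture HSemireg — EVERY PARABOLIC SUBSTITUTION HAS THE JORDAN DATA OF THE SHEAR: for a substitution `g` with a DOUBLE fixed node (`λ₁ ∈ K` finite with `γ ≠ 0`, or `∞` with
# `g = (α β; 0 α)`, `β ≠ 0`) and eigenvalue `a` on the letters, `SbC(g) − a^n` is conjugate to `a^n·(SbC(shear) − 1)` on th-7's classes, so in characteristic `p` its
# nilpotency index is `min(p, n+1)` (J3) and `dim ker (SbC(g) − a^n) = ⌊n/p⌋ + 1` Jordan blocks (J4); in characteristic `0` one block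

HONEST FRAMING. Part of the Lean index of the computation cell `pub-hsemireg` (seat p10 gen 20, Sunday typer «UNIFORM-IN-n»).
Finite-dimensional EXTERIOR ALGEBRA + linear algebra ONLY: no variety, no cohomology theory, no sheaf, no Ext group, no semiregularity map;
nothing here says that HC / HC_CM / HC_AV holds; no Literature fact is declared or used.  Custodian versions as in `WedgeHankelSiegelIdeal` (1/3) and `WedgeHankelFrameChange`.

WHAT IS IN THE TREE.  I9 `sbMat_mul_eq_of_fixed_one` (`S(g)·S(1 λ₁ 0 1) = S(1 λ₁ 0 1)·S(α+λ₁γ, 0, γ, δ−λ₁γ)`), `charpoly_sbMat_of_parabolic` (`(X − a^c)^{c+1}`); I8 (one eigen-line);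
J5 (`WedgeHankelClassSpaceAlgebra`): `SbC_mul`, `SbC_scalar`; I18 `SbC_shear_mul_shear`, `SbC_shear_zero`; J3 `SbC_shear_sub_one_pow_eq_zero_iff_char`; J4 `finrank_ker_SbC_shear_sub_one_char`,
`finrank_ker_SbC_shear_sub_one_charZero`.  THIS FILE (namespace `Summit.Ventures.HSemireg.Wedge.HankelFrameChange` continued; imports J4, J5) transports J3/J4 to every parabolic `g`:
* §247 CONJUGATION ON THE CLASS SPACE: `SbC_mul_shear_of_fixed_one` (`SbC(g)·SbC(1 λ₁ 0 1) = SbC(1 λ₁ 0 1)·SbC(α+λ₁γ, 0, γ, δ−λ₁γ)`), `SbC_lower_parabolic` (`SbC(a 0 c a) = a^n • SbC(1 0 c/a 1)`),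
  `SbC_swap_mul_swap` (`S·S = 1`, `S = SbC(0 1 1 0)`), `SbC_lower_shear_eq_swap_conj` (`SbC(1 0 c 1) = S·SbC(1 c 0 1)·S`), `SbC_shear_mul_shear_neg` / `SbC_shear_neg_mul_shear`, and the packaged identity **`SbC_sub_mul_conj_of_parabolic`**:
  `(SbC(g) − a^n)·Q = Q·(a^n • (SbC(shear γ/a) − 1))` with `Q = SbC(1 λ₁ 0 1)·S` and its explicit inverse (`conj_mul_inv`, `inv_mul_conj`).
* §248 generalities on conjugate endomorphisms (`pow_eq_conj_of_mul_eq`, `pow_eq_zero_iff_of_conj`, `ker_eq_map_of_conj`, `finrank_ker_eq_of_conj`) and the consequences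
  **`SbC_sub_pow_eq_zero_iff_of_parabolic`** (`(SbC(g) − a^n)^k = 0 ⇔ (SbC(shear γ/a) − 1)^k = 0`, every field), **`finrank_ker_SbC_sub_of_parabolic`** (`dim ker(SbC(g) − a^n) =
  dim ker(SbC(shear γ/a) − 1)`).
* §249 readings: **`SbC_sub_pow_eq_zero_iff_of_parabolic_char`** (char `p`: `⇔ min(p, n+1) ≤ k`), **`finrank_ker_SbC_sub_of_parabolic_char`** (`= n / p + 1`),
  `finrank_ker_SbC_sub_of_parabolic_charZero` (`= 1`); and the fixed node at `∞`: **`SbC_upper_parabolic`** (`SbC(α β 0 α) = α^n • SbC(shear β/α)`),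
  `finrank_ker_SbC_upper_parabolic_sub_char` (`= n / p + 1`).
NOT typed here: parabolic `g` whose double node is not `K`-rational (impossible: a double root of a quadratic over `K` lies in `K` when `2 ≠ 0`; in characteristic `2` inseparable
nodes exist and are not treated); anything Ext-side.  New names only.
-/

open Module

namespace Summit.Ventures.HSemireg.Wedge.HankelFrameChange

open Summit.Ventures.HSemireg.Wedge Summit.Ventures.HSemireg.Wedge.Kunneth Summit.Ventures.HSemireg.Wedge.Hankel
  Summit.Ventures.HSemireg.Wedge.BasisFree Summit.Ventures.HSemireg.Wedge.HankelSiegel Summit.Ventures.HSemireg.Wedge.HankelSiegelIdeal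
  Summit.Ventures.HSemireg.Wedge.KunnethKernel Summit.Ventures.HSemireg.Wedge.HankelRankOne Summit.Ventures.HSemireg.Wedge.KernelDuality

variable (K : Type*) [Field K] {n : ℕ}

/-! ## §247. Conjugating a parabolic substitution to a scalar times the shear, on the class space -/

/-- **`SbC(g)·SbC(1 λ₁ 0 1) = SbC(1 λ₁ 0 1)·SbC(α+λ₁γ, 0, γ, δ−λ₁γ)`** for a fixed node `λ₁` (`β + λ₁δ = λ₁(α + λ₁γ)`; I9's matrix identity read through I11 `toMatrix_SbC`). -/
theorem SbC_mul_shear_of_fixed_one {α β γ δ l₁ : K} (e₁ : β + l₁ * δ = l₁ * (α + l₁ * γ)) :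
    SbC K α β γ δ (n := n) * SbC K 1 l₁ 0 1 = SbC K 1 l₁ 0 1 * SbC K (α + l₁ * γ) 0 γ (δ - l₁ * γ) := by
  apply (LinearMap.toMatrix (spikeBasis K n) (spikeBasis K n)).injective
  simp only [LinearMap.toMatrix_mul, toMatrix_SbC]
  exact sbMat_mul_eq_of_fixed_one K e₁ n

/-- **`SbC(a 0 c a) = a^n • SbC(1 0 c/a 1)`** (`a ≠ 0`): a lower parabolic substitution is a scalar times a lower shear on the classes (J5 `SbC_mul`, `SbC_scalar`). -/
theorem SbC_lower_parabolic {a : K} (ha : a ≠ 0) (c : K) : SbC K a 0 c a (n := n) = a ^ n • SbC K 1 0 (c / a) 1 := by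
  have h : SbC K a 0 0 a (n := n) * SbC K 1 0 (c / a) 1 = SbC K a 0 c a := by
    rw [SbC_mul]; congr 1 <;> simp [ha]
  rw [← h, SbC_scalar, smul_mul_assoc, one_mul]

/-- the swap is an involution on the classes: `SbC(0 1 1 0)·SbC(0 1 1 0) = 1`. -/
theorem SbC_swap_mul_swap : SbC K 0 1 1 0 (n := n) * SbC K 0 1 1 0 = 1 := by
  rw [SbC_mul, ← SbC_shear_zero K (n := n)]
  congr 1 <;> ring

/-- **`SbC(1 0 c 1) = SbC(0 1 1 0)·SbC(1 c 0 1)·SbC(0 1 1 0)`**: the lower shear is the swap-conjugate of the upper shear on the classes. -/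
theorem SbC_lower_shear_eq_swap_conj (c : K) : SbC K 1 0 c 1 (n := n) = SbC K 0 1 1 0 * SbC K 1 c 0 1 * SbC K 0 1 1 0 := by
  rw [SbC_mul, SbC_mul]
  congr 1 <;> ring

/-- `SbC(1 λ 0 1)·SbC(1 (−λ) 0 1) = 1`. -/
theorem SbC_shear_mul_shear_neg (lam : K) : SbC K 1 lam 0 1 (n := n) * SbC K 1 (-lam) 0 1 = 1 := by
  rw [SbC_shear_mul_shear, add_neg_cancel, SbC_shear_zero]

/-- `SbC(1 (−λ) 0 1)·SbC(1 λ 0 1) = 1`. -/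
theorem SbC_shear_neg_mul_shear (lam : K) : SbC K 1 (-lam) 0 1 (n := n) * SbC K 1 lam 0 1 = 1 := by
  rw [SbC_shear_mul_shear, neg_add_cancel, SbC_shear_zero]

/-- the conjugator `Q = SbC(1 λ₁ 0 1)·SbC(0 1 1 0)` and its inverse `Q′ = SbC(0 1 1 0)·SbC(1 (−λ₁) 0 1)`: `Q·Q′ = 1`. -/
theorem conj_mul_inv (l₁ : K) : (SbC K 1 l₁ 0 1 (n := n) * SbC K 0 1 1 0) * (SbC K 0 1 1 0 * SbC K 1 (-l₁) 0 1) = 1 := by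
  rw [mul_assoc, ← mul_assoc (SbC K 0 1 1 0), SbC_swap_mul_swap, one_mul, SbC_shear_mul_shear_neg]

/-- … and `Q′·Q = 1`. -/
theorem inv_mul_conj (l₁ : K) : (SbC K 0 1 1 0 (n := n) * SbC K 1 (-l₁) 0 1) * (SbC K 1 l₁ 0 1 * SbC K 0 1 1 0) = 1 := by
  rw [mul_assoc, ← mul_assoc (SbC K 1 (-l₁) 0 1), SbC_shear_neg_mul_shear, one_mul, SbC_swap_mul_swap]

/-- **THE CONJUGATION: `(SbC(g) − a^n)·Q = Q·(a^n • (SbC(1 (γ/a) 0 1) − 1))`** for a parabolic `g` — fixed node `λ₁` with `β + λ₁δ = λ₁(α+λ₁γ)`, double: `δ − λ₁γ = α + λ₁γ = a ≠ 0` —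
with `Q = SbC(1 λ₁ 0 1)·SbC(0 1 1 0)`. -/
theorem SbC_sub_mul_conj_of_parabolic {α β γ δ l₁ : K} (e₁ : β + l₁ * δ = l₁ * (α + l₁ * γ)) (hpar : δ - l₁ * γ = α + l₁ * γ) (ha : α + l₁ * γ ≠ 0) :
    (SbC K α β γ δ (n := n) - (α + l₁ * γ) ^ n • 1) * (SbC K 1 l₁ 0 1 * SbC K 0 1 1 0) =
      (SbC K 1 l₁ 0 1 * SbC K 0 1 1 0) * ((α + l₁ * γ) ^ n • (SbC K 1 (γ / (α + l₁ * γ)) 0 1 - 1)) := by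
  have h1 := SbC_mul_shear_of_fixed_one K (n := n) e₁
  rw [hpar, SbC_lower_parabolic K ha, SbC_lower_shear_eq_swap_conj] at h1
  -- `h1 : SbC g * P = P * (a^n • (S * U * S))`; compare both sides on every class `f`, using `S (S f) = f`
  refine LinearMap.ext fun f => ?_
  have hSS : SbC K 0 1 1 0 (SbC K 0 1 1 0 f) = f := by rw [← Module.End.mul_apply, SbC_swap_mul_swap, Module.End.one_apply]
  have h1f := LinearMap.congr_fun h1 (SbC K 0 1 1 0 f)
  simp only [Module.End.mul_apply, LinearMap.smul_apply, hSS] at h1f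
  simp only [Module.End.mul_apply, LinearMap.sub_apply, LinearMap.smul_apply, Module.End.one_apply, map_sub, map_smul, h1f, smul_sub]

/-! ## §248. Consequences: powers and kernels are conjugate -/

section Conj

variable {V : Type*} [AddCommGroup V] [Module K V]

/-- from `A·Q = Q·B` and `Q·Q′ = 1`: `A^k = Q·B^k·Q′`. -/
theorem pow_eq_conj_of_mul_eq {A B Q Q' : Module.End K V} (h : A * Q = Q * B) (hQ : Q * Q' = 1) (k : ℕ) : A ^ k = Q * B ^ k * Q' := by
  have hk : A ^ k * Q = Q * B ^ k := by
    induction k with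
    | zero => rw [pow_zero, pow_zero, one_mul, mul_one]
    | succ k ih => rw [pow_succ, mul_assoc, h, ← mul_assoc, ih, mul_assoc, ← pow_succ]
  rw [← hk, mul_assoc, hQ, mul_one]

/-- from `A·Q = Q·B` with `Q` invertible: `A^k = 0 ⇔ B^k = 0`. -/
theorem pow_eq_zero_iff_of_conj {A B Q Q' : Module.End K V} (h : A * Q = Q * B) (hQ : Q * Q' = 1) (hQ' : Q' * Q = 1) (k : ℕ) : A ^ k = 0 ↔ B ^ k = 0 := by
  have e := pow_eq_conj_of_mul_eq K h hQ k
  constructor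
  · intro hA
    have e2 : Q' * A ^ k * Q = B ^ k := by rw [e, ← mul_assoc, ← mul_assoc, hQ', one_mul, mul_assoc, hQ', mul_one]
    rw [← e2, hA, mul_zero, zero_mul]
  · intro hB
    rw [e, hB, mul_zero, zero_mul]

/-- from `A·Q = Q·B` with `Q` invertible: `ker A = Q(ker B)`. -/
theorem ker_eq_map_of_conj {A B Q Q' : Module.End K V} (h : A * Q = Q * B) (hQ : Q * Q' = 1) (hQ' : Q' * Q = 1) :
    LinearMap.ker A = (LinearMap.ker B).map Q := by
  have e : A = Q * B * Q' := by simpa only [pow_one] using pow_eq_conj_of_mul_eq K h hQ 1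
  ext x
  have hx : Q (Q' x) = x := by rw [← Module.End.mul_apply, hQ, Module.End.one_apply]
  rw [Submodule.mem_map, LinearMap.mem_ker]
  constructor
  · intro hA
    refine ⟨Q' x, ?_, hx⟩
    rw [LinearMap.mem_ker]
    have h2 : Q' (A x) = B (Q' x) := by
      rw [e, Module.End.mul_apply, Module.End.mul_apply, ← Module.End.mul_apply Q' Q, hQ', Module.End.one_apply]
    rw [← h2, hA, map_zero]
  · rintro ⟨y, hy, rfl⟩
    rw [LinearMap.mem_ker] at hy
    rw [e, Module.End.mul_apply, Module.End.mul_apply, ← Module.End.mul_apply Q' Q, hQ', Module.End.one_apply, hy, map_zero]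

/-- … so the kernels have the same dimension. -/
theorem finrank_ker_eq_of_conj [FiniteDimensional K V] {A B Q Q' : Module.End K V} (h : A * Q = Q * B) (hQ : Q * Q' = 1) (hQ' : Q' * Q = 1) :
    finrank K ↥(LinearMap.ker A) = finrank K ↥(LinearMap.ker B) := by
  let e : V ≃ₗ[K] V := LinearEquiv.ofLinear Q Q' hQ hQ'
  rw [ker_eq_map_of_conj K h hQ hQ', show (Q : Module.End K V) = (e : V →ₗ[K] V) from rfl, LinearEquiv.finrank_map_eq]

end Conj

/-- **`(SbC(g) − a^n)^k = 0 ⇔ (SbC(shear γ/a) − 1)^k = 0`** for a parabolic `g` (every field): the two endomorphisms are conjugate up to the unit `a^n`. -/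
theorem SbC_sub_pow_eq_zero_iff_of_parabolic {α β γ δ l₁ : K} (e₁ : β + l₁ * δ = l₁ * (α + l₁ * γ)) (hpar : δ - l₁ * γ = α + l₁ * γ) (ha : α + l₁ * γ ≠ 0) (k : ℕ) :
    (SbC K α β γ δ (n := n) - (α + l₁ * γ) ^ n • 1) ^ k = 0 ↔ (SbC K 1 (γ / (α + l₁ * γ)) 0 1 (n := n) - 1) ^ k = 0 := by
  rw [pow_eq_zero_iff_of_conj K (SbC_sub_mul_conj_of_parabolic K e₁ hpar ha) (conj_mul_inv K l₁) (inv_mul_conj K l₁) k, smul_pow, smul_eq_zero]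
  exact or_iff_right (pow_ne_zero k (pow_ne_zero n ha))

/-- **`dim ker (SbC(g) − a^n) = dim ker (SbC(shear γ/a) − 1)`** for a parabolic `g` (every field): the number of Jordan blocks agrees with the shear's. -/
theorem finrank_ker_SbC_sub_of_parabolic {α β γ δ l₁ : K} (e₁ : β + l₁ * δ = l₁ * (α + l₁ * γ)) (hpar : δ - l₁ * γ = α + l₁ * γ) (ha : α + l₁ * γ ≠ 0) :
    finrank K ↥(LinearMap.ker (SbC K α β γ δ (n := n) - (α + l₁ * γ) ^ n • 1)) = finrank K ↥(LinearMap.ker (SbC K 1 (γ / (α + l₁ * γ)) 0 1 (n := n) - 1)) := by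
  rw [finrank_ker_eq_of_conj K (SbC_sub_mul_conj_of_parabolic K e₁ hpar ha) (conj_mul_inv K l₁) (inv_mul_conj K l₁),
    LinearMap.ker_smul _ _ (pow_ne_zero n ha)]

/-! ## §249. The readings in characteristic `p` and `0`; the double node at `∞` -/

/-- **CHARACTERISTIC `p`: the nilpotency index of `SbC(g) − a^n` for a NON-SCALAR parabolic `g` (`γ ≠ 0`) is `min(p, n+1)`** (J3). -/
theorem SbC_sub_pow_eq_zero_iff_of_parabolic_char {α β γ δ l₁ : K} (e₁ : β + l₁ * δ = l₁ * (α + l₁ * γ)) (hpar : δ - l₁ * γ = α + l₁ * γ) (ha : α + l₁ * γ ≠ 0)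
    (hγ : γ ≠ 0) (p : ℕ) [Fact p.Prime] [CharP K p] (k : ℕ) :
    (SbC K α β γ δ (n := n) - (α + l₁ * γ) ^ n • 1) ^ k = 0 ↔ min p (n + 1) ≤ k := by
  rw [SbC_sub_pow_eq_zero_iff_of_parabolic K e₁ hpar ha, SbC_shear_sub_one_pow_eq_zero_iff_char K (div_ne_zero hγ ha) p k]

/-- **CHARACTERISTIC `p`: a NON-SCALAR parabolic substitution has EXACTLY `⌊n/p⌋ + 1` JORDAN BLOCKS on th-7's classes: `dim ker (SbC(g) − a^n) = n / p + 1`** (J4). -/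
theorem finrank_ker_SbC_sub_of_parabolic_char {α β γ δ l₁ : K} (e₁ : β + l₁ * δ = l₁ * (α + l₁ * γ)) (hpar : δ - l₁ * γ = α + l₁ * γ) (ha : α + l₁ * γ ≠ 0)
    (hγ : γ ≠ 0) (p : ℕ) [Fact p.Prime] [CharP K p] :
    finrank K ↥(LinearMap.ker (SbC K α β γ δ (n := n) - (α + l₁ * γ) ^ n • 1)) = n / p + 1 := by
  rw [finrank_ker_SbC_sub_of_parabolic K e₁ hpar ha, finrank_ker_SbC_shear_sub_one_char K (div_ne_zero hγ ha) p]

/-- characteristic `0`: ONE Jordan block (`dim ker (SbC(g) − a^n) = 1`; I8's one eigen-line, counted). -/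
theorem finrank_ker_SbC_sub_of_parabolic_charZero [CharZero K] {α β γ δ l₁ : K} (e₁ : β + l₁ * δ = l₁ * (α + l₁ * γ)) (hpar : δ - l₁ * γ = α + l₁ * γ)
    (ha : α + l₁ * γ ≠ 0) (hγ : γ ≠ 0) :
    finrank K ↥(LinearMap.ker (SbC K α β γ δ (n := n) - (α + l₁ * γ) ^ n • 1)) = 1 := by
  rw [finrank_ker_SbC_sub_of_parabolic K e₁ hpar ha, finrank_ker_SbC_shear_sub_one_charZero K (div_ne_zero hγ ha)]

/-- **THE DOUBLE NODE AT `∞`: `SbC(α β 0 α) = α^n • SbC(1 (β/α) 0 1)`** (`α ≠ 0`): an upper parabolic substitution is a scalar times the shear itself. -/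
theorem SbC_upper_parabolic {α : K} (hα : α ≠ 0) (β : K) : SbC K α β 0 α (n := n) = α ^ n • SbC K 1 (β / α) 0 1 := by
  have h : SbC K α 0 0 α (n := n) * SbC K 1 (β / α) 0 1 = SbC K α β 0 α := by
    rw [SbC_mul]; congr 1 <;> simp [hα]
  rw [← h, SbC_scalar, smul_mul_assoc, one_mul]

/-- characteristic `p`, double node at `∞` (`β ≠ 0`): `dim ker (SbC(α β 0 α) − α^n) = n / p + 1` Jordan blocks. -/
theorem finrank_ker_SbC_upper_parabolic_sub_char {α β : K} (hα : α ≠ 0) (hβ : β ≠ 0) (p : ℕ) [Fact p.Prime] [CharP K p] :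
    finrank K ↥(LinearMap.ker (SbC K α β 0 α (n := n) - α ^ n • 1)) = n / p + 1 := by
  have e : α ^ n • SbC K 1 (β / α) 0 1 (n := n) - α ^ n • 1 = α ^ n • (SbC K 1 (β / α) 0 1 - 1) :=
    LinearMap.ext fun f => by simp only [LinearMap.sub_apply, LinearMap.smul_apply, Module.End.one_apply, smul_sub]
  rw [SbC_upper_parabolic K hα, e, LinearMap.ker_smul _ _ (pow_ne_zero n hα), finrank_ker_SbC_shear_sub_one_char K (div_ne_zero hβ hα) p]

end Summit.Ventures.HSemireg.Wedge.HankelFrameChange
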